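import Mathlib.Analysis.Normed.Field.Basic
import Mathlib.Tactic.NoncommRing
import HarnessLib

/-!
# THE ALGEBRAIC SKELETON OF THE (I-curv) DISCHARGER: discrete Leibniz and resolvent identities for DOUBLE DIFFERENCES of `K⁻¹·H` over a
# two-parameter square in a normed ring, and the explicit BILINEAR bound `‖ΔΔ(K⁻¹H)‖ ≤ C·s·t` — def-free, [folklore]

Cell `ym3-torus` (YM ladder rung R3 = continuum `SU(2)` Yang–Mills on the three-torus — a RUNG: NOT d = 4, NOT infinite volume, NOT a mass gap,
NOT Clay).  LEAD-20520 width seat `ym-ust-20520-w3` (gen 28), LEAD №17 CLAIM; `--kind proof --supports stmt-QuantumFields-20520 --as helper`,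
count-neutral, definition-free, default heartbeats, `autoImplicit false`; no registry ∕ binder ∕ `Lines/` ∕ row edit (registry
`Lines/semiclassical_s2beta.lean` 3732b7df UNTOUCHED).

WHAT THIS IS.  DISCHARGE-SPEC v1.8 §11 (xv) (LEAD RULING №56: covariant organ OF RECORD after FL-36c `Q_c = 1.150`) names the ONE print-shaped item
the (I-curv) letters `kG ∕ kB` of ROW-sq v0.4 (A5) are to be instantiated from: «the second variation, under two coarse one-bond moves, of the
gauge-invariant one-loop traces `tr(K_V^{−1} H^O_V)` in a smooth small background is bounded by `C(O)·e^{−κ·tdist(b,b′)}` UNIFORMLY in the IR cutoff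
`L^m`» ([Balaban1984PropagatorsII] random-walk expansions; [Balaban1987RG1] §1–2).  Its proof has two layers: (1) ALGEBRA — the mixed second
difference of `V ↦ K_V^{−1}H_V` over the four corners of a coarse square is an explicit sum of products of resolvents `K^{−1}`, first∕second
differences of `K` and of `H`; (2) ANALYSIS — random-walk ∕ decay bounds on those factors after the trace.  This file is layer (1), ONCE, for
an arbitrary normed ring `R` (intended inhabitants: the matrices `K_{V}` (horizontal Wilson Hessian at the constrained minimiser) and `H^O_V` at the
four corners `V ∈ {U, U·e^{v}@b, U·e^{v′}@b′, U·e^{v}@b·e^{v′}@b′}`; inverses are passed as DATA `A i j` with `A·K = 1 = K·A`, so no completeness or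
`Ring.inverse` API is needed):
* §1 ★`doubleDiff_mul_eq` — DISCRETE LEIBNIZ: `ΔΔ(A·H) = A₁₁·ΔΔH + (A₁₁ − A₀₁)·(H₀₁ − H₀₀) + (A₁₁ − A₁₀)·(H₁₀ − H₀₀) + ΔΔA·H₀₀` (`noncomm_ring`).
* §2 ★`inv_sub_inv_eq` — FIRST RESOLVENT IDENTITY `A₁ − A₀ = −A₁·(K₁ − K₀)·A₀`; ★`norm_inv_sub_inv_le`; ★★`norm_doubleDiff_inv_le` — the SECOND-ORDER
  resolvent bound `‖ΔΔA‖ ≤ a²·‖ΔΔK‖ + a³·(‖Δ¹K₀‖·‖Δ²K₀‖ + ‖Δ²K₁‖·‖Δ¹K₀‖)` from the first identity applied three times.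
* §3 ★★★`norm_doubleDiff_inv_mul_le` — THE BILINEAR BOUND: with `‖A i j‖ ≤ a`, `‖H i j‖ ≤ h`, `‖Δ¹K‖ ≤ k₁·s`, `‖Δ²K‖ ≤ k₂·t`, `‖ΔΔK‖ ≤ k₁₂·s·t` and
  `‖Δ¹H‖ ≤ h₁·s`, `‖Δ²H‖ ≤ h₂·t`, `‖ΔΔH‖ ≤ h₁₂·s·t` (`s, t ≥ 0` the two move sizes):
  `‖ΔΔ(K⁻¹H)‖ ≤ (a·h₁₂ + a²·(k₁·h₂ + k₂·h₁) + (a²·k₁₂ + 2·a³·k₁·k₂)·h)·s·t` — the `HClauseSq`-shaped letter of the one-loop object BEFORE the trace;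
  ★★`abs_doubleDiff_functional_le` — the same through any additive functional `φ : R →+ ℝ` with `|φ x| ≤ c·‖x‖` (a trace, a matrix entry, a
  localised trace): `|ΔΔ φ(K⁻¹H)| ≤ c·(…)·s·t`.
INHABITATION (★★OWNER RULING №100): LAW-FREE — pure algebra of four ring elements and their given inverses; the organ objects expected to
inhabit it are `K_V = P_V H(A_V) P_V|_{hor}` and `H^O_V` at the corners of a near coarse square (own algebra; no fibre law, no score).
WHAT THIS IS NOT: layer (2) — that the letters `a, k₁, k₂, k₁₂, h₁, h₂, h₁₂` of the actual `K_V, H^O_V` are m-UNIFORM with `tdist`-decay after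
the trace (the content of (xv), [Balaban1984PropagatorsII]) — is NOT touched; nothing of Bałaban's analysis is asserted or proved;
`OrganDischargeInputsHJ(sq)` v0.1–v0.4 ∕ `SpreadFibreLawH(J)(sq)` UNDISCHARGED; O1ᵘ-H, S1aᴴ, S2α′, S2β, 26243, the five registered stubs, crux 20520
`FluctuationComparisonRegPrIntL` and `YM3TorusSU2` are NOT proved; no summit ∕ sub-problem statement is proved by a helper; rung R3 = SU(2) YM₃ on T³
at fixed lattice data — NOT d = 4, NOT infinite volume, NOT a mass gap, NOT Clay; the Yang–Mills mass gap is NOT proved.  [folklore] normed-ring algebra.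
-/

set_option autoImplicit false

namespace Summit.QuantumFields.YangMills.Theorems.OrganTangentResolventDoubleDifference

/-! ## §1 Discrete Leibniz for the double difference of a product -/

section Leibniz

variable {R : Type*} [Ring R]

/-- ★ **DISCRETE LEIBNIZ** for the mixed second difference of a product over a two-parameter square (indices `i j ∈ {0,1}` written as the
four corners `X₀₀ X₀₁ X₁₀ X₁₁`): `ΔΔ(A·H) = A₁₁·ΔΔH + (A₁₁ − A₀₁)·(H₀₁ − H₀₀) + (A₁₁ − A₁₀)·(H₁₀ − H₀₀) + ΔΔA·H₀₀`. [folklore] -/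
theorem doubleDiff_mul_eq (A₀₀ A₀₁ A₁₀ A₁₁ H₀₀ H₀₁ H₁₀ H₁₁ : R) :
    A₁₁ * H₁₁ - A₁₀ * H₁₀ - A₀₁ * H₀₁ + A₀₀ * H₀₀ =
      A₁₁ * (H₁₁ - H₁₀ - H₀₁ + H₀₀) + (A₁₁ - A₀₁) * (H₀₁ - H₀₀) + (A₁₁ - A₁₀) * (H₁₀ - H₀₀) +
        (A₁₁ - A₁₀ - A₀₁ + A₀₀) * H₀₀ := by
  noncomm_ring

end Leibniz

/-! ## §2 Resolvent identities: differences of inverses -/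

section Resolvent

variable {R : Type*} [NormedRing R]

/-- ★ **FIRST RESOLVENT IDENTITY** with inverses as data: if `A₁·K₁ = 1` and `K₀·A₀ = 1` then `A₁ − A₀ = −(A₁·(K₁ − K₀)·A₀)`. [folklore] -/
theorem inv_sub_inv_eq {K₀ K₁ A₀ A₁ : R} (h₁ : A₁ * K₁ = 1) (h₀ : K₀ * A₀ = 1) :
    A₁ - A₀ = -(A₁ * (K₁ - K₀) * A₀) := by
  have e : A₁ * (K₁ - K₀) * A₀ = A₁ * K₁ * A₀ - A₁ * (K₀ * A₀) := by noncomm_ring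
  rw [e, h₁, h₀, one_mul, mul_one]
  abel

/-- ★ Norm form of the first resolvent identity: `‖A₁ − A₀‖ ≤ ‖A₁‖·‖K₁ − K₀‖·‖A₀‖`. [folklore] -/
theorem norm_inv_sub_inv_le {K₀ K₁ A₀ A₁ : R} (h₁ : A₁ * K₁ = 1) (h₀ : K₀ * A₀ = 1) :
    ‖A₁ - A₀‖ ≤ ‖A₁‖ * ‖K₁ - K₀‖ * ‖A₀‖ := by
  rw [inv_sub_inv_eq h₁ h₀, norm_neg]
  exact (norm_mul_le _ _).trans (mul_le_mul_of_nonneg_right (norm_mul_le _ _) (norm_nonneg _))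

/-- With a uniform bound `‖A₀‖, ‖A₁‖ ≤ a`: `‖A₁ − A₀‖ ≤ a²·‖K₁ − K₀‖`. [folklore] -/
theorem norm_inv_sub_inv_le' {K₀ K₁ A₀ A₁ : R} {a : ℝ} (h₁ : A₁ * K₁ = 1) (h₀ : K₀ * A₀ = 1)
    (hA₀ : ‖A₀‖ ≤ a) (hA₁ : ‖A₁‖ ≤ a) :
    ‖A₁ - A₀‖ ≤ a ^ 2 * ‖K₁ - K₀‖ := by
  have ha : 0 ≤ a := (norm_nonneg _).trans hA₀
  calc ‖A₁ - A₀‖ ≤ ‖A₁‖ * ‖K₁ - K₀‖ * ‖A₀‖ := norm_inv_sub_inv_le h₁ h₀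
    _ ≤ a * ‖K₁ - K₀‖ * a := by gcongr
    _ = a ^ 2 * ‖K₁ - K₀‖ := by ring

/-- ★★ **SECOND-ORDER RESOLVENT BOUND.**  Four invertible corners `K i j` with two-sided inverses `A i j` (as data), `‖A i j‖ ≤ a`:
`‖ΔΔA‖ ≤ a²·‖ΔΔK‖ + a³·(‖K₁₀ − K₀₀‖·‖K₀₁ − K₀₀‖ + ‖K₁₁ − K₁₀‖·‖K₁₀ − K₀₀‖)` — from
`ΔΔA = (A₁₁ − A₀₁) − (A₁₀ − A₀₀) = −A₁₁(Δ¹K₁)A₀₁ + A₁₀(Δ¹K₀)A₀₀` regrouped as `−A₁₁·ΔΔK·A₀₁ − A₁₁·Δ¹K₀·(A₀₁ − A₀₀) − (A₁₁ − A₁₀)·Δ¹K₀·A₀₀`. [folklore] -/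
theorem norm_doubleDiff_inv_le {K₀₀ K₀₁ K₁₀ K₁₁ A₀₀ A₀₁ A₁₀ A₁₁ : R} {a : ℝ}
    (_hl₀₀ : A₀₀ * K₀₀ = 1) (hr₀₀ : K₀₀ * A₀₀ = 1) (hl₀₁ : A₀₁ * K₀₁ = 1) (hr₀₁ : K₀₁ * A₀₁ = 1)
    (hl₁₀ : A₁₀ * K₁₀ = 1) (hr₁₀ : K₁₀ * A₁₀ = 1) (hl₁₁ : A₁₁ * K₁₁ = 1) (_hr₁₁ : K₁₁ * A₁₁ = 1)
    (hA₀₀ : ‖A₀₀‖ ≤ a) (hA₀₁ : ‖A₀₁‖ ≤ a) (hA₁₀ : ‖A₁₀‖ ≤ a) (hA₁₁ : ‖A₁₁‖ ≤ a) :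
    ‖A₁₁ - A₁₀ - A₀₁ + A₀₀‖ ≤
      a ^ 2 * ‖K₁₁ - K₁₀ - K₀₁ + K₀₀‖ +
        a ^ 3 * (‖K₁₀ - K₀₀‖ * ‖K₀₁ - K₀₀‖ + ‖K₁₁ - K₁₀‖ * ‖K₁₀ - K₀₀‖) := by
  have ha : 0 ≤ a := (norm_nonneg _).trans hA₀₀
  -- the regrouped identity
  have e1 : A₁₁ - A₀₁ = -(A₁₁ * (K₁₁ - K₀₁) * A₀₁) := inv_sub_inv_eq hl₁₁ hr₀₁
  have e2 : A₁₀ - A₀₀ = -(A₁₀ * (K₁₀ - K₀₀) * A₀₀) := inv_sub_inv_eq hl₁₀ hr₀₀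
  have key : A₁₁ - A₁₀ - A₀₁ + A₀₀ =
      -(A₁₁ * (K₁₁ - K₁₀ - K₀₁ + K₀₀) * A₀₁) - A₁₁ * (K₁₀ - K₀₀) * (A₀₁ - A₀₀)
        - (A₁₁ - A₁₀) * (K₁₀ - K₀₀) * A₀₀ := by
    have : A₁₁ - A₁₀ - A₀₁ + A₀₀ = (A₁₁ - A₀₁) - (A₁₀ - A₀₀) := by abel
    rw [this, e1, e2]
    noncomm_ring
  have b1 : ‖A₀₁ - A₀₀‖ ≤ a ^ 2 * ‖K₀₁ - K₀₀‖ := norm_inv_sub_inv_le' hl₀₁ hr₀₀ hA₀₀ hA₀₁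
  have b2 : ‖A₁₁ - A₁₀‖ ≤ a ^ 2 * ‖K₁₁ - K₁₀‖ := norm_inv_sub_inv_le' hl₁₁ hr₁₀ hA₁₀ hA₁₁
  rw [key]
  have t1 : ‖-(A₁₁ * (K₁₁ - K₁₀ - K₀₁ + K₀₀) * A₀₁)‖ ≤ a ^ 2 * ‖K₁₁ - K₁₀ - K₀₁ + K₀₀‖ := by
    rw [norm_neg]
    calc ‖A₁₁ * (K₁₁ - K₁₀ - K₀₁ + K₀₀) * A₀₁‖ ≤ ‖A₁₁‖ * ‖K₁₁ - K₁₀ - K₀₁ + K₀₀‖ * ‖A₀₁‖ :=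
          (norm_mul_le _ _).trans (mul_le_mul_of_nonneg_right (norm_mul_le _ _) (norm_nonneg _))
      _ ≤ a * ‖K₁₁ - K₁₀ - K₀₁ + K₀₀‖ * a := by gcongr
      _ = a ^ 2 * ‖K₁₁ - K₁₀ - K₀₁ + K₀₀‖ := by ring
  have t2 : ‖A₁₁ * (K₁₀ - K₀₀) * (A₀₁ - A₀₀)‖ ≤ a ^ 3 * (‖K₁₀ - K₀₀‖ * ‖K₀₁ - K₀₀‖) := by
    calc ‖A₁₁ * (K₁₀ - K₀₀) * (A₀₁ - A₀₀)‖ ≤ ‖A₁₁‖ * ‖K₁₀ - K₀₀‖ * ‖A₀₁ - A₀₀‖ :=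
          (norm_mul_le _ _).trans (mul_le_mul_of_nonneg_right (norm_mul_le _ _) (norm_nonneg _))
      _ ≤ a * ‖K₁₀ - K₀₀‖ * (a ^ 2 * ‖K₀₁ - K₀₀‖) := by gcongr
      _ = a ^ 3 * (‖K₁₀ - K₀₀‖ * ‖K₀₁ - K₀₀‖) := by ring
  have t3 : ‖(A₁₁ - A₁₀) * (K₁₀ - K₀₀) * A₀₀‖ ≤ a ^ 3 * (‖K₁₁ - K₁₀‖ * ‖K₁₀ - K₀₀‖) := by
    calc ‖(A₁₁ - A₁₀) * (K₁₀ - K₀₀) * A₀₀‖ ≤ ‖A₁₁ - A₁₀‖ * ‖K₁₀ - K₀₀‖ * ‖A₀₀‖ :=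
          (norm_mul_le _ _).trans (mul_le_mul_of_nonneg_right (norm_mul_le _ _) (norm_nonneg _))
      _ ≤ (a ^ 2 * ‖K₁₁ - K₁₀‖) * ‖K₁₀ - K₀₀‖ * a := by gcongr
      _ = a ^ 3 * (‖K₁₁ - K₁₀‖ * ‖K₁₀ - K₀₀‖) := by ring
  have n1 := norm_sub_le (-(A₁₁ * (K₁₁ - K₁₀ - K₀₁ + K₀₀) * A₀₁) - A₁₁ * (K₁₀ - K₀₀) * (A₀₁ - A₀₀))
    ((A₁₁ - A₁₀) * (K₁₀ - K₀₀) * A₀₀)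
  have n2 := norm_sub_le (-(A₁₁ * (K₁₁ - K₁₀ - K₀₁ + K₀₀) * A₀₁)) (A₁₁ * (K₁₀ - K₀₀) * (A₀₁ - A₀₀))
  linarith [n1, n2, t1, t2, t3]

end Resolvent

/-! ## §3 The bilinear bound for `ΔΔ(K⁻¹·H)` -/

section Bilinear

variable {R : Type*} [NormedRing R]

/-- ★★★ **THE BILINEAR BOUND FOR THE ONE-LOOP OBJECT BEFORE THE TRACE.**  Four invertible corners `K i j` (two-sided inverses `A i j` as data,
`‖A i j‖ ≤ a`), four elements `H i j` (`‖H i j‖ ≤ h`), move sizes `s, t ≥ 0`, and the first∕second-difference letters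
`‖K₁ⱼ − K₀ⱼ‖ ≤ k₁·s`, `‖Kᵢ₁ − Kᵢ₀‖ ≤ k₂·t`, `‖ΔΔK‖ ≤ k₁₂·s·t`, `‖H₁ⱼ − H₀ⱼ‖ ≤ h₁·s`, `‖Hᵢ₁ − Hᵢ₀‖ ≤ h₂·t`, `‖ΔΔH‖ ≤ h₁₂·s·t` (`k₁, k₂ ≥ 0`).  THEN
`‖ΔΔ(A·H)‖ ≤ (a·h₁₂ + a²·(k₁·h₂ + k₂·h₁) + (a²·k₁₂ + 2·a³·k₁·k₂)·h)·s·t` (§1 Leibniz + §2 resolvent bounds). [folklore] -/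
theorem norm_doubleDiff_inv_mul_le {K₀₀ K₀₁ K₁₀ K₁₁ A₀₀ A₀₁ A₁₀ A₁₁ H₀₀ H₀₁ H₁₀ H₁₁ : R}
    {a h k₁ k₂ k₁₂ h₁ h₂ h₁₂ s t : ℝ}
    (hl₀₀ : A₀₀ * K₀₀ = 1) (hr₀₀ : K₀₀ * A₀₀ = 1) (hl₀₁ : A₀₁ * K₀₁ = 1) (hr₀₁ : K₀₁ * A₀₁ = 1)
    (hl₁₀ : A₁₀ * K₁₀ = 1) (hr₁₀ : K₁₀ * A₁₀ = 1) (hl₁₁ : A₁₁ * K₁₁ = 1) (hr₁₁ : K₁₁ * A₁₁ = 1)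
    (hA₀₀ : ‖A₀₀‖ ≤ a) (hA₀₁ : ‖A₀₁‖ ≤ a) (hA₁₀ : ‖A₁₀‖ ≤ a) (hA₁₁ : ‖A₁₁‖ ≤ a)
    (hH₀₀ : ‖H₀₀‖ ≤ h) (hs : 0 ≤ s) (ht : 0 ≤ t)
    (hk₁ : 0 ≤ k₁) (hk₂ : 0 ≤ k₂)
    (hK1a : ‖K₁₀ - K₀₀‖ ≤ k₁ * s) (hK1b : ‖K₁₁ - K₀₁‖ ≤ k₁ * s)
    (hK2a : ‖K₀₁ - K₀₀‖ ≤ k₂ * t) (hK2b : ‖K₁₁ - K₁₀‖ ≤ k₂ * t)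
    (hK12 : ‖K₁₁ - K₁₀ - K₀₁ + K₀₀‖ ≤ k₁₂ * s * t)
    (hH1 : ‖H₁₀ - H₀₀‖ ≤ h₁ * s) (hH2 : ‖H₀₁ - H₀₀‖ ≤ h₂ * t)
    (hH12 : ‖H₁₁ - H₁₀ - H₀₁ + H₀₀‖ ≤ h₁₂ * s * t) :
    ‖A₁₁ * H₁₁ - A₁₀ * H₁₀ - A₀₁ * H₀₁ + A₀₀ * H₀₀‖ ≤
      (a * h₁₂ + a ^ 2 * (k₁ * h₂ + k₂ * h₁) + (a ^ 2 * k₁₂ + 2 * a ^ 3 * k₁ * k₂) * h) * s * t := by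
  have ha : 0 ≤ a := (norm_nonneg _).trans hA₀₀
  have hh : 0 ≤ h := (norm_nonneg _).trans hH₀₀
  rw [doubleDiff_mul_eq]
  -- the four Leibniz terms
  have T1 : ‖A₁₁ * (H₁₁ - H₁₀ - H₀₁ + H₀₀)‖ ≤ a * (h₁₂ * s * t) :=
    (norm_mul_le _ _).trans (mul_le_mul hA₁₁ hH12 (norm_nonneg _) ha)
  have D1 : ‖A₁₁ - A₀₁‖ ≤ a ^ 2 * ‖K₁₁ - K₀₁‖ := norm_inv_sub_inv_le' hl₁₁ hr₀₁ hA₀₁ hA₁₁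
  have D2 : ‖A₁₁ - A₁₀‖ ≤ a ^ 2 * ‖K₁₁ - K₁₀‖ := norm_inv_sub_inv_le' hl₁₁ hr₁₀ hA₁₀ hA₁₁
  have T2 : ‖(A₁₁ - A₀₁) * (H₀₁ - H₀₀)‖ ≤ (a ^ 2 * (k₁ * s)) * (h₂ * t) := by
    refine (norm_mul_le _ _).trans (mul_le_mul (D1.trans ?_) hH2 (norm_nonneg _) (by positivity))
    exact mul_le_mul_of_nonneg_left hK1b (sq_nonneg a)
  have T3 : ‖(A₁₁ - A₁₀) * (H₁₀ - H₀₀)‖ ≤ (a ^ 2 * (k₂ * t)) * (h₁ * s) := by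
    refine (norm_mul_le _ _).trans (mul_le_mul (D2.trans ?_) hH1 (norm_nonneg _) (by positivity))
    exact mul_le_mul_of_nonneg_left hK2b (sq_nonneg a)
  have DD : ‖A₁₁ - A₁₀ - A₀₁ + A₀₀‖ ≤ a ^ 2 * (k₁₂ * s * t) + a ^ 3 * ((k₁ * s) * (k₂ * t) + (k₂ * t) * (k₁ * s)) := by
    have base := norm_doubleDiff_inv_le hl₀₀ hr₀₀ hl₀₁ hr₀₁ hl₁₀ hr₁₀ hl₁₁ hr₁₁ hA₀₀ hA₀₁ hA₁₀ hA₁₁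
    refine base.trans ?_
    have ha2 : 0 ≤ a ^ 2 := sq_nonneg a
    have ha3 : 0 ≤ a ^ 3 := pow_nonneg ha 3
    have p1 : ‖K₁₀ - K₀₀‖ * ‖K₀₁ - K₀₀‖ ≤ (k₁ * s) * (k₂ * t) :=
      mul_le_mul hK1a hK2a (norm_nonneg _) (by positivity)
    have p2 : ‖K₁₁ - K₁₀‖ * ‖K₁₀ - K₀₀‖ ≤ (k₂ * t) * (k₁ * s) :=
      mul_le_mul hK2b hK1a (norm_nonneg _) (by positivity)
    nlinarith [mul_le_mul_of_nonneg_left hK12 ha2, mul_le_mul_of_nonneg_left (add_le_add p1 p2) ha3]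
  have T4 : ‖(A₁₁ - A₁₀ - A₀₁ + A₀₀) * H₀₀‖ ≤ (a ^ 2 * (k₁₂ * s * t) + a ^ 3 * ((k₁ * s) * (k₂ * t) + (k₂ * t) * (k₁ * s))) * h :=
    (norm_mul_le _ _).trans (mul_le_mul DD hH₀₀ (norm_nonneg _) ((norm_nonneg _).trans DD))
  have n1 := norm_add_le (A₁₁ * (H₁₁ - H₁₀ - H₀₁ + H₀₀) + (A₁₁ - A₀₁) * (H₀₁ - H₀₀) + (A₁₁ - A₁₀) * (H₁₀ - H₀₀))
    ((A₁₁ - A₁₀ - A₀₁ + A₀₀) * H₀₀)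
  have n2 := norm_add_le (A₁₁ * (H₁₁ - H₁₀ - H₀₁ + H₀₀) + (A₁₁ - A₀₁) * (H₀₁ - H₀₀)) ((A₁₁ - A₁₀) * (H₁₀ - H₀₀))
  have n3 := norm_add_le (A₁₁ * (H₁₁ - H₁₀ - H₀₁ + H₀₀)) ((A₁₁ - A₀₁) * (H₀₁ - H₀₀))
  have e : (a * h₁₂ + a ^ 2 * (k₁ * h₂ + k₂ * h₁) + (a ^ 2 * k₁₂ + 2 * a ^ 3 * k₁ * k₂) * h) * s * t =
      a * (h₁₂ * s * t) + (a ^ 2 * (k₁ * s)) * (h₂ * t) + (a ^ 2 * (k₂ * t)) * (h₁ * s) +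
        (a ^ 2 * (k₁₂ * s * t) + a ^ 3 * ((k₁ * s) * (k₂ * t) + (k₂ * t) * (k₁ * s))) * h := by ring
  rw [e]
  linarith [n1, n2, n3, T1, T2, T3, T4]

/-- ★★ **THROUGH A BOUNDED ADDITIVE FUNCTIONAL** (a trace, a matrix entry, a localised trace): for `φ : R →+ ℝ` with `|φ x| ≤ c·‖x‖` (`c ≥ 0`), under the
hypotheses of ★★★`norm_doubleDiff_inv_mul_le`, the real mixed second difference of `φ(A·H)` over the square obeys
`|φ(A₁₁H₁₁) − φ(A₁₀H₁₀) − φ(A₀₁H₀₁) + φ(A₀₀H₀₀)| ≤ c·(a·h₁₂ + a²·(k₁·h₂ + k₂·h₁) + (a²·k₁₂ + 2·a³·k₁·k₂)·h)·s·t` — the `HClauseSq` letter SHAPE of the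
one-loop object `φ(K_V^{−1}H^O_V)`; the m-uniformity of the letters is the discharger's ([Balaban1984PropagatorsII]). [folklore] -/
theorem abs_doubleDiff_functional_le {K₀₀ K₀₁ K₁₀ K₁₁ A₀₀ A₀₁ A₁₀ A₁₁ H₀₀ H₀₁ H₁₀ H₁₁ : R}
    {a h k₁ k₂ k₁₂ h₁ h₂ h₁₂ s t c : ℝ} (φ : R →+ ℝ) (hc : 0 ≤ c) (hφ : ∀ x, |φ x| ≤ c * ‖x‖)
    (hl₀₀ : A₀₀ * K₀₀ = 1) (hr₀₀ : K₀₀ * A₀₀ = 1) (hl₀₁ : A₀₁ * K₀₁ = 1) (hr₀₁ : K₀₁ * A₀₁ = 1)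
    (hl₁₀ : A₁₀ * K₁₀ = 1) (hr₁₀ : K₁₀ * A₁₀ = 1) (hl₁₁ : A₁₁ * K₁₁ = 1) (hr₁₁ : K₁₁ * A₁₁ = 1)
    (hA₀₀ : ‖A₀₀‖ ≤ a) (hA₀₁ : ‖A₀₁‖ ≤ a) (hA₁₀ : ‖A₁₀‖ ≤ a) (hA₁₁ : ‖A₁₁‖ ≤ a)
    (hH₀₀ : ‖H₀₀‖ ≤ h) (hs : 0 ≤ s) (ht : 0 ≤ t)
    (hk₁ : 0 ≤ k₁) (hk₂ : 0 ≤ k₂)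
    (hK1a : ‖K₁₀ - K₀₀‖ ≤ k₁ * s) (hK1b : ‖K₁₁ - K₀₁‖ ≤ k₁ * s)
    (hK2a : ‖K₀₁ - K₀₀‖ ≤ k₂ * t) (hK2b : ‖K₁₁ - K₁₀‖ ≤ k₂ * t)
    (hK12 : ‖K₁₁ - K₁₀ - K₀₁ + K₀₀‖ ≤ k₁₂ * s * t)
    (hH1 : ‖H₁₀ - H₀₀‖ ≤ h₁ * s) (hH2 : ‖H₀₁ - H₀₀‖ ≤ h₂ * t)
    (hH12 : ‖H₁₁ - H₁₀ - H₀₁ + H₀₀‖ ≤ h₁₂ * s * t) :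
    |φ (A₁₁ * H₁₁) - φ (A₁₀ * H₁₀) - φ (A₀₁ * H₀₁) + φ (A₀₀ * H₀₀)| ≤
      c * ((a * h₁₂ + a ^ 2 * (k₁ * h₂ + k₂ * h₁) + (a ^ 2 * k₁₂ + 2 * a ^ 3 * k₁ * k₂) * h) * s * t) := by
  have e : φ (A₁₁ * H₁₁) - φ (A₁₀ * H₁₀) - φ (A₀₁ * H₀₁) + φ (A₀₀ * H₀₀) =
      φ (A₁₁ * H₁₁ - A₁₀ * H₁₀ - A₀₁ * H₀₁ + A₀₀ * H₀₀) := by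
    simp only [map_sub, map_add]
  rw [e]
  refine (hφ _).trans ?_
  exact mul_le_mul_of_nonneg_left
    (norm_doubleDiff_inv_mul_le hl₀₀ hr₀₀ hl₀₁ hr₀₁ hl₁₀ hr₁₀ hl₁₁ hr₁₁ hA₀₀ hA₀₁ hA₁₀ hA₁₁ hH₀₀ hs ht hk₁ hk₂
      hK1a hK1b hK2a hK2b hK12 hH1 hH2 hH12) hc

end Bilinear

end Summit.QuantumFields.YangMills.Theorems.OrganTangentResolventDoubleDifference
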